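import Summits.CriticalPhenomena.PercolationContinuityZ3.Theorems.Transplant.PlanarSkeletonFrmQuasiProxies
import Summits.CriticalPhenomena.PercolationContinuityZ3.Theorems.Transplant.SkelFrmFrom1ChoiceLTK
import Summits.CriticalPhenomena.PercolationContinuityZ3.Theorems.Transplant.PlanarSkeletonFrmQuasiDefs
import Summits.CriticalPhenomena.PercolationContinuityZ3.Theorems.Transplant.PlanarSkeletonFrmQuasiReflect
import Summits.CriticalPhenomena.PercolationContinuityZ3.Theorems.Transplant.SkelFrmQuasi1ChoiceDefs
import Summits.CriticalPhenomena.PercolationContinuityZ3.Theorems.Transplant.SkelFrmQuasi1ChoiceL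
import Summits.CriticalPhenomena.PercolationContinuityZ3.Theorems.Transplant.SkelFrmQuasi1SlotTypes
import HarnessLib

/-!
# GEN-Q PORT (WAVE-Q table v0.8 section 2, row G279, U-level ?; captain R-6/R-7 2026-08-27: carrier token swap `PlanarSkeletonFrmFrom ↦ PlanarSkeletonFrmQuasi`)
# of the tree module «Transplant/SkelFrmFrom1ChoiceDefsPx» (sha256 0d85318f0ae8750d…) onto the quasi-step carrier `PlanarSkeletonFrmQuasi` (p507026): «SkelFrmQuasi1ChoiceDefsPx»

ORIGINAL TITLE: 

builds on p205010 (kernel theorem, internal audit signed; external expert review pending) — nothing in this file uses p205010; NOTHING is claimed about any open node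
((N3-b), the end state).  Lane `prim-bschramm`, seat `prim-bschramm-gen-1` (gen 4; binder-wave captain).  Helper file (`--supports stmt-CriticalPhenomena-4575 --as helper`).
PORT RULES (U-wave r1–r4 re-used, GEN-Q hunk classes of p3-g29 #6136): declaration order, names and proof texts are those of «SkelFrmFrom1ChoiceDefsPx», byte-identical except
(i) the carrier token `PlanarSkeletonFrmFrom ↦ PlanarSkeletonFrmQuasi` in binders, `namespace`/`end` lines and qualified names (module names `SkelFrmFrom… ↦ SkelFrmQuasi…`
in imports of already-ported rows); (ii) `Φ.step ↦ Φ.qstep` with the called Steps lemma replaced by its `…Q`/`_q` twin and the cost `Φ.M` threaded (none in this file unless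
listed below); (iii) `Φ.cyl_connected ↦ Φ.cyl_reach` readers (none unless listed); (iv) graph-ball radii / window floors ×`Φ.M` (none unless listed).  Carrier-free
residents stay imported/exported from the original «SkelFrm1ChoiceDefsPx» exactly as in the FrmFrom port.  Docstrings and citations are the original's.

-/

noncomputable section

open MeasureTheory ProbabilityTheory
open scoped ENNReal Classical

namespace Summit.CriticalPhenomena.PercolationContinuityZ3.Theorems.Transplant

open Literature.Probability.Percolation Literature.Probability.LatticeModels SimpleGraph KNCells KNLevels
open Literature.Barriers.CriticalPhenomena (HasExponentialGrowth)
open SkelConc (Consts)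

namespace PlanarSkeletonFrmQuasi

export PlanarSkeletonFrm (ChainFactQT)  -- T3-auto: resident alias replicated from the FrmFrom namespace
export PlanarSkeletonFrm (FlatQ)  -- T3-auto: resident alias replicated from the FrmFrom namespace

/-! ## §1 The uniform-in-`D` variants (first filing; superseded FOR THE NODE by §2's `…PxAt` forms — kept, append-only) -/

-- GEN-Q (R-2, captain 2026-08-27): `PlanarSkeletonFrmFrom.ChoiceFnNQPx` is not in the used cone of the node top — not ported.

-- GEN-Q (R-2, captain 2026-08-27): `PlanarSkeletonFrmFrom.GeomHoldsNQFnPx` is not in the used cone of the node top — not ported.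

-- GEN-Q (R-2, captain 2026-08-27): `PlanarSkeletonFrmFrom.RootHoldsNQWFnLKPx` is not in the used cone of the node top — not ported.

-- GEN-Q (R-2, captain 2026-08-27): `PlanarSkeletonFrmFrom.FaceHoldsRNQFnLTKPx` is not in the used cone of the node top — not ported.

-- GEN-Q (R-2, captain 2026-08-27): `PlanarSkeletonFrmFrom.ReachHoldsRHNQFnLKPx` is not in the used cone of the node top — not ported.

/-! ## §2 (appended 2026-08-26, same seat) THE FORMS OF RECORD: the proxy radius `D` as a PARAMETER — `ChoiceFnNQPxAt D` and the four column obligations `…PxAt`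

WHY A SECOND SET (append-only; §1's five definitions stay as the uniform-in-`D` variants and are NOT what the node reads): in §1 the radius `D` is bound INSIDE the
choice function (`∀ D, Φ.HasProxies t D → …`), so ONE choice function must serve every radius and its SLOTS cannot depend on `D`; but the choice function of record's
slot floors DO move with `D` (kit-radius / box floors `… KS.Rs … + D …`, WAVE-Us-MANIFEST §6, §10 C-2/C-4, §11 (e)).  With `D` a PARAMETER (this §2), the U_s node
fixes the one radius `D = D(Φ)` it gets from `hasProxies_coarseFrmFrom` (dictionary part 4) and names the choice function of record AT THAT `D`
(«SkelFrmFromBChoiceDefsVPx»: `frmChoiceAllQ3VPx D slots…`), the GEN column rows keep the U slot binders `(gv fv : Neg.FSlot) …` and their slot-floor hypotheses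
verbatim up to `+ D`, and the column tops instantiate the tuple of record at `D`.  Texts: §1's with `(D : ℕ)` moved from the ∀ to the parameters; bodies = the
𝒞-level U definitions verbatim.  Consumers: the GEN closure top «SkelFrmFrom1ChoiceLTKPx» (`drop_of_choiceFnNQLTKPx_at`) and the four GEN column tops. -/

/-- **A GEN choice function AT PROXY RADIUS `D`** (the form of record; WAVE-Us-MANIFEST §2 (i)): the N2/U choice function `ChoiceFnNQ` over every frames-only skeleton
NOT of exponential growth, at a base vertex `t ∈ Φ.types` WITH PROXIES at radius `D` (`Φ.HasProxies t D` in place of `Φ.types = {t}`), every `0 < p < 1` and Φ2 —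
returning the SAME data `ChoiceNQ κ Φ t p hC`; `D` is a parameter of the type, so the slots of a choice function may depend on it.  (Applied to the REFLECTED skeleton in
the GEN closure, as `ChoiceFnNQ` is, (R-25) — reflections keep `D`, `HasProxies.reflect`; U is the instance `D = 0` by `HasProxies.of_types_eq`.) [this work] -/
def ChoiceFnNQPxAt (D : ℕ) : Type 1 :=
  ∀ (κ : Consts) {V : Type} [DecidableEq V] [Countable V] (G : SimpleGraph V) [G.LocallyFinite] (Φ : PlanarSkeletonFrmQuasi G),
    ¬ HasExponentialGrowth G → ∀ (t : V), t ∈ Φ.types → Φ.HasProxies t D → ∀ (p : unitInterval), 0 < (p : ℝ) → (p : ℝ) < 1 →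
      ∀ (hC : Φ.CylSubcritical p), ChoiceNQ κ Φ t p hC

/-- **The geometric obligation of a GEN choice function at radius `D`** (`GeomHoldsNQFn` with the binder swap `(h1) ↦ (hP : Φ.HasProxies t D)`; body
`ChoiceNQ.GeomHoldsNQ` verbatim). [this work] -/
def GeomHoldsNQFnPxAt {D : ℕ} (𝒞₀ : ChoiceFnNQPxAt D) : Prop :=
  ∀ (κ : Consts) {V : Type} [DecidableEq V] [Countable V] (G : SimpleGraph V) [G.LocallyFinite] (Φ : PlanarSkeletonFrmQuasi G)
    (hg : ¬ HasExponentialGrowth G) (t : V) (ht : t ∈ Φ.types) (hP : Φ.HasProxies t D) (p : unitInterval) (hp0 : 0 < (p : ℝ)) (hp1 : (p : ℝ) < 1)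
    (hC : Φ.CylSubcritical p), (𝒞₀ κ G Φ hg t ht hP p hp0 hp1 hC).GeomHoldsNQ

/-- **The (R) column Prop under the K-floor for a GEN choice function at radius `D`**: the forward law-carrying root obligation GIVEN the flat root table, asked only
for `Kmin ≤ κ.K₀` (`RootHoldsNQWFnLK` with the binder swap `(h1) ↦ (hP : Φ.HasProxies t D)`; body `ChoiceNQ.RootHoldsNQW` verbatim). [this work] -/
def RootHoldsNQWFnLKPxAt (Lf : ℕ → ℕ) (Kmin : ℕ) {D : ℕ} (𝒞₀ : ChoiceFnNQPxAt D) : Prop :=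
  ∀ (κ : Consts) {V : Type} [DecidableEq V] [Countable V] (G : SimpleGraph V) [G.LocallyFinite] (Φ : PlanarSkeletonFrmQuasi G)
    (hg : ¬ HasExponentialGrowth G) (t : V) (ht : t ∈ Φ.types) (hP : Φ.HasProxies t D) (p : unitInterval) (hp0 : 0 < (p : ℝ)) (hp1 : (p : ℝ) < 1)
    (hC : Φ.CylSubcritical p), Kmin ≤ κ.K₀ → FlatQ Lf κ → (𝒞₀ κ G Φ hg t ht hP p hp0 hp1 hC).RootHoldsNQW

/-- **The (F) column Prop under the K-floor for a GEN choice function at radius `D`**: the face obligation GIVEN flatness and the face inner-chain fact at target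
accuracy `dT κ.δ₂`, asked only for `Kmin ≤ κ.K₀` (`FaceHoldsRNQFnLTK` with the binder swap `(h1) ↦ (hP : Φ.HasProxies t D)`; body `ChoiceNQ.FaceHoldsRNQ` verbatim).
[this work] -/
def FaceHoldsRNQFnLTKPxAt (Lf : ℕ → ℕ) (dT : ℝ → ℝ) (Kmin : ℕ) {D : ℕ} (𝒞₀ : ChoiceFnNQPxAt D) : Prop :=
  ∀ (κ : Consts) {V : Type} [DecidableEq V] [Countable V] (G : SimpleGraph V) [G.LocallyFinite] (Φ : PlanarSkeletonFrmQuasi G)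
    (hg : ¬ HasExponentialGrowth G) (t : V) (ht : t ∈ Φ.types) (hP : Φ.HasProxies t D) (p : unitInterval) (hp0 : 0 < (p : ℝ)) (hp1 : (p : ℝ) < 1)
    (hC : Φ.CylSubcritical p), Kmin ≤ κ.K₀ → FlatQ Lf κ → ChainFactQT Lf G Φ.Δ κ (dT κ.δ₂) → (𝒞₀ κ G Φ hg t ht hP p hp0 hp1 hC).FaceHoldsRNQ

/-- **The (C) column Prop under the K-floor for a GEN choice function at radius `D`**: the length-budgeted corridor obligation, asked only for `Kmin ≤ κ.K₀`
(`ReachHoldsRHNQFnLK` with the binder swap `(h1) ↦ (hP : Φ.HasProxies t D)`; body `ChoiceNQ.ReachHoldsRHNQL` verbatim). [this work] -/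
def ReachHoldsRHNQFnLKPxAt (Lf : ℕ → ℕ) (Kmin : ℕ) {D : ℕ} (𝒞₀ : ChoiceFnNQPxAt D) : Prop :=
  ∀ (κ : Consts) {V : Type} [DecidableEq V] [Countable V] (G : SimpleGraph V) [G.LocallyFinite] (Φ : PlanarSkeletonFrmQuasi G)
    (hg : ¬ HasExponentialGrowth G) (t : V) (ht : t ∈ Φ.types) (hP : Φ.HasProxies t D) (p : unitInterval) (hp0 : 0 < (p : ℝ)) (hp1 : (p : ℝ) < 1)
    (hC : Φ.CylSubcritical p), Kmin ≤ κ.K₀ → (𝒞₀ κ G Φ hg t ht hP p hp0 hp1 hC).ReachHoldsRHNQL Lf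

-- GEN-Q (R-2, captain 2026-08-27): `PlanarSkeletonFrmFrom.ChoiceFnNQPx.geomHoldsNQFnPxAt_at` is not in the used cone of the node top — not ported.

end PlanarSkeletonFrmQuasi

end Summit.CriticalPhenomena.PercolationContinuityZ3.Theorems.Transplant

end
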